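import Mathlib.FieldTheory.Galois.Infinite
import Mathlib.NumberTheory.Padics.Complex
import Literature.AlgebraicGeometry.Frobenioids.QuasiTemperoidGaloisPadicFields
import Literature.AnabelianGeometry.SemiGraphs.CosetCategories
import HarnessLib

/-!
# The field functor `𝓑(K_v)⁰ → D₀`, `Spec L ↦ L` with its valuation ([IUTchI] Ex. 3.3 (i); [FrdII] Ex. 1.1 (i))

Mochizuki, *Inter-universal Teichmüller Theory I*, kurims manuscript (May 2020), Ex. 3.3 (i) p. 78
[cite: Mochizuki2012, I Ex 3.3 (i) p.78]: "`D⊢_v := 𝓑(K_v)⁰` … For `Spec(L) ∈ Ob(D⊢_v)` [i.e., `L` is a finite separable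
extension of `K_v`], write `ord(𝒪^▷_L) := 𝒪^▷_L/𝒪^×_L` as in [FrdII], Example 1.1, (i)"; Mochizuki, *The geometry of
Frobenioids II*, Ex. 1.1 (i) p. 7 [cite: MochizukiFrdII2008, Ex 1.1 (i) p.7]: the base `D₀` of "finite extensions of
`ℚ_p`" with their rings of integers (abc-iut-L1-t4's `PadicFrd.PadicFld p`: valued fields in which `p` is a nonzero
non-unit integer, morphisms the valuative ring homomorphisms).

This file CONSTRUCTS that functor on the small model `CosetCat G` (`CosetCategories.lean`) of `𝓑(K_v)⁰` for
`G := Gal(Ω/k)` with its Krull topology, `Ω/k` Galois (in print `Ω = K̄_v`, `k = K_v`):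
* INPUT `GaloisValDatum p`: the valued field `k` (a `p`-adic local field: `p ∈ 𝒪^▷_k` a non-unit, `k` finite over
  `ℚ_p` compatibly with the valuations), a Galois extension `Ω` carrying a valuative relation that EXTENDS that of `k`
  (`ValuativeExtension k Ω`) and is INVARIANT under `Gal(Ω/k)` (`val_aut`) — the latter two are the classical
  "uniqueness of the extension of the valuation of a complete field" (for `k = K_v` complete: Mathlib's
  `spectralNorm_eq_of_equiv`); here they are hypotheses (fields of the input), discharged at `ℚ_p`/elsewhere, not
  asserted;
* `GaloisValDatum.fieldFunctor : CosetCat Gal(Ω/k) ⥤ PadicFld p`, `U ↦ Ω^U` (the fixed field, with the restricted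
  valuative relation `valOn`), a morphism `G/U → G/V` with point `g·V` going to `Spec Ω^U → Spec Ω^V`, i.e. to the
  valuative ring homomorphism `Ω^V → Ω^U`, `x ↦ g·x` (`fixedHom`; independent of the representative `g`);
* `GaloisValDatum.fieldFunctor_isPadicLocal`: every `Ω^U` (`U` OPEN) is a `p`-adic local field — finite over `k` by
  infinite Galois theory (`InfiniteGalois.isOpen_iff_finite`, `fixingSubgroup_fixedField` for the closed subgroup `U`),
  hence over `ℚ_p`, with compatible valuations.
Pure field/valuation theory over Mathlib; nothing of the disputed series is asserted. The assembly with the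
Frobenioid side (`GoodLocalFrobenioid.ofSubDatum`) is the sibling `GoodLocalFrobenioidOfGalois.lean`.
-/

namespace Literature.IUT.HodgeTheaters

open CategoryTheory Literature.AnabelianGeometry.SemiGraphs Literature.AlgebraicGeometry.Frobenioids
open Literature.AlgebraicGeometry.Frobenioids.PadicFrd

universe u

/-- **INPUT of the field functor of [IUTchI] Ex. 3.3 (i)**: a `p`-adic local field `k` (= `K_v`), a Galois extension
`Ω/k` (= `K̄_v`) with a valuative relation extending that of `k` and invariant under `Gal(Ω/k)` (uniqueness of the
extension of a complete valuation — a hypothesis here). [cite: Mochizuki2012, I Ex 3.3 (i) p.78] -/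
structure GaloisValDatum (p : ℕ) [Fact p.Prime] : Type (u + 1) where
  /-- the base field `k = K_v` -/
  k : Type u
  [fieldk : Field k]
  [valk : ValuativeRel k]
  /-- the Galois extension `Ω = K̄_v` -/
  Ω : Type u
  [fieldΩ : Field Ω]
  [algΩ : Algebra k Ω]
  [valΩ : ValuativeRel Ω]
  [isGalois : IsGalois k Ω]
  /-- the valuative relation of `Ω` extends that of `k` -/
  [valExt : ValuativeExtension k Ω]
  /-- the valuative relation of `Ω` is `Gal(Ω/k)`-invariant -/
  val_aut : ∀ (σ : Ω ≃ₐ[k] Ω) (x y : Ω), σ x ≤ᵥ σ y ↔ x ≤ᵥ y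
  /-- `p ∈ 𝒪^▷_k` … -/
  p_mem : ((p : ℕ) : k) ∈ intNonzero k
  /-- … is not a unit: `v(p) < 1` -/
  p_lt : ValuativeRel.valuation k ((p : ℕ) : k) < 1
  /-- `k` is a finite extension of `ℚ_p` with its `p`-adic valuation -/
  isPadicLocal : (PadicFld.mk (p := p) k p_mem p_lt).IsPadicLocal

namespace GaloisValDatum

attribute [instance] GaloisValDatum.fieldk GaloisValDatum.valk GaloisValDatum.fieldΩ GaloisValDatum.algΩ
  GaloisValDatum.valΩ GaloisValDatum.isGalois GaloisValDatum.valExt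

variable {p : ℕ} [Fact p.Prime] (d : GaloisValDatum.{u} p)

/-- `G_v := Gal(Ω/k)` with its Krull topology (a profinite group). [cite: Mochizuki2012, I Ex 3.3 (i) p.78] -/
abbrev Gal : Type u := d.Ω ≃ₐ[d.k] d.Ω

/-- The base field `Spec k` as an object of `D₀`. [cite: MochizukiFrdII2008, Ex 1.1 (i) p.7] -/
def basePadicFld : PadicFld.{u} p := PadicFld.mk (p := p) d.k d.p_mem d.p_lt

/-- The fixed field `Ω^U` of an open subgroup (the finite extension `L` of `k` with `Spec L = G/U`).
[cite: Mochizuki2012, I Ex 3.3 (i) p.78] -/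
abbrev fixedFld (X : CosetCat d.Gal) : IntermediateField d.k d.Ω := IntermediateField.fixedField X.sg.toSubgroup

/-- The valuative relation of `Ω` restricted to a subfield `E ⊆ Ω` ("`𝒪_L`", the ring of integers of `L`, as the
valuation ring of the restricted valuation). [cite: MochizukiFrdII2008, Ex 1.1 (i) p.7] -/
@[reducible] noncomputable def valOn (E : IntermediateField d.k d.Ω) : ValuativeRel E :=
  ValuativeRel.ofValuation ((ValuativeRel.valuation d.Ω).comap (algebraMap E d.Ω))

/-- The restricted relation is the relation of `Ω` on elements of `E`. [cite: MochizukiFrdII2008, Ex 1.1 (i) p.7] -/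
theorem valOn_iff (E : IntermediateField d.k d.Ω) (x y : E) :
    @ValuativeRel.vle E _ (d.valOn E) x y ↔ (x : d.Ω) ≤ᵥ (y : d.Ω) := by
  change ValuativeRel.valuation d.Ω (algebraMap E d.Ω x) ≤ ValuativeRel.valuation d.Ω (algebraMap E d.Ω y) ↔ _
  rw [← Valuation.Compatible.vle_iff_le]
  rfl

/-- In `k`: `p ≤ᵥ 1` and `¬ 1 ≤ᵥ p`. [cite: MochizukiFrdII2008, Ex 1.1 (i) p.7] -/
theorem p_vle_one : ((p : ℕ) : d.k) ≤ᵥ 1 ∧ ¬ (1 : d.k) ≤ᵥ ((p : ℕ) : d.k) := by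
  constructor
  · have h := d.p_mem.1
    rw [← (ValuativeRel.valuation d.k).map_one, ← Valuation.Compatible.vle_iff_le] at h
    exact h
  · intro h
    rw [Valuation.Compatible.vle_iff_le (v := ValuativeRel.valuation d.k), map_one] at h
    exact not_le.mpr d.p_lt h

/-- In `Ω`: `p ≤ᵥ 1` and `¬ 1 ≤ᵥ p` (the relation of `Ω` extends that of `k`). [cite: MochizukiFrdII2008, Ex 1.1 (i) p.7] -/
theorem p_vle_one_Ω : ((p : ℕ) : d.Ω) ≤ᵥ 1 ∧ ¬ (1 : d.Ω) ≤ᵥ ((p : ℕ) : d.Ω) := by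
  have h1 := (ValuativeExtension.vle_iff_vle (A := d.k) (B := d.Ω) ((p : ℕ) : d.k) 1)
  have h2 := (ValuativeExtension.vle_iff_vle (A := d.k) (B := d.Ω) 1 ((p : ℕ) : d.k))
  rw [map_natCast, map_one] at h1 h2
  exact ⟨h1.mpr d.p_vle_one.1, fun h => d.p_vle_one.2 (h2.mp h)⟩

/-- `p ≠ 0` in `Ω`. [cite: MochizukiFrdII2008, Ex 1.1 (i) p.7] -/
theorem p_ne_zero_Ω : ((p : ℕ) : d.Ω) ≠ 0 := by
  rw [← map_natCast (algebraMap d.k d.Ω)]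
  exact (map_ne_zero _).mpr d.p_mem.2

/-- `p ∈ 𝒪^▷` of every subfield `E` of `Ω` containing `k`. [cite: MochizukiFrdII2008, Ex 1.1 (i) p.7] -/
theorem p_mem_on (E : IntermediateField d.k d.Ω) : ((p : ℕ) : E) ∈ @intNonzero E _ (d.valOn E) := by
  letI := d.valOn E
  refine ⟨?_, fun h => d.p_ne_zero_Ω (by rw [← SubringClass.coe_natCast E p, h]; rfl)⟩
  rw [← (ValuativeRel.valuation E).map_one, ← Valuation.Compatible.vle_iff_le, d.valOn_iff,
    SubringClass.coe_natCast, OneMemClass.coe_one]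
  exact d.p_vle_one_Ω.1

/-- `p` is not a unit of `𝒪` of any subfield `E` of `Ω` containing `k`. [cite: MochizukiFrdII2008, Ex 1.1 (i) p.7] -/
theorem p_lt_on (E : IntermediateField d.k d.Ω) :
    @ValuativeRel.valuation E _ (d.valOn E) ((p : ℕ) : E) < 1 := by
  letI := d.valOn E
  rw [lt_iff_not_ge, ← (ValuativeRel.valuation E).map_one, ← Valuation.Compatible.vle_iff_le, d.valOn_iff,
    SubringClass.coe_natCast, OneMemClass.coe_one]
  exact d.p_vle_one_Ω.2

/-- **`Spec Ω^U` as an object of `D₀`**: the fixed field of `U` with the restricted valuation (Ex. 3.3 (i): "for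
`Spec(L) ∈ Ob(D⊢_v)` [i.e., `L` is a finite separable extension of `K_v`]"). [cite: Mochizuki2012, I Ex 3.3 (i) p.78] -/
noncomputable def fieldObj (X : CosetCat d.Gal) : PadicFld.{u} p :=
  @PadicFld.mk p (d.fixedFld X) _ (d.valOn (d.fixedFld X)) (d.p_mem_on _) (d.p_lt_on _)

/-! ### Morphisms: `G/U → G/V` with point `g·V` ↦ (`Ω^V → Ω^U`, `x ↦ g·x`) -/

/-- A representative acts on `Ω^V` independently of the choice: for `g ∈ c = gV` and `x ∈ Ω^V`, `c.out x = g x`.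
[cite: Mochizuki2012, I Ex 3.3 (i) p.78] -/
theorem out_apply_eq (V : Subgroup d.Gal) (g : d.Gal) (x : IntermediateField.fixedField V) :
    (Quotient.out (g : d.Gal ⧸ V)) (x : d.Ω) = g (x : d.Ω) := by
  obtain ⟨v, hv⟩ := QuotientGroup.mk_out_eq_mul V g
  rw [hv, AlgEquiv.mul_apply]
  congr 1
  exact (IntermediateField.mem_fixedField_iff V (x : d.Ω)).mp x.2 v v.2

/-- For a `U`-fixed coset `c ∈ G/V` and `x ∈ Ω^V`, `c · x ∈ Ω^U` (if `u g V = g V` then `g⁻¹ u g ∈ V` fixes `x`).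
[cite: Mochizuki2012, I Ex 3.3 (i) p.78] -/
theorem out_apply_mem {X Y : CosetCat d.Gal} (f : X ⟶ Y) (x : d.fixedFld Y) :
    (Quotient.out (CosetCat.pt f)) (x : d.Ω) ∈ d.fixedFld X := by
  obtain ⟨g, hg⟩ := Quotient.exists_rep (CosetCat.pt f)
  have hg' : CosetCat.pt f = (g : d.Gal ⧸ Y.sg.toSubgroup) := hg.symm
  rw [hg', out_apply_eq]
  refine (IntermediateField.mem_fixedField_iff _ _).mpr fun u hu => ?_
  have hfix := CosetCat.smul_pt f hu
  rw [hg', MulAction.Quotient.smul_coe, QuotientGroup.eq, smul_eq_mul] at hfix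
  -- `(u * g)⁻¹ * g ∈ V`, i.e. `g⁻¹ u⁻¹ g ∈ V`; apply it to `x`
  have hx := (IntermediateField.mem_fixedField_iff Y.sg.toSubgroup (x : d.Ω)).mp x.2 _ hfix
  rw [mul_inv_rev, AlgEquiv.mul_apply, AlgEquiv.mul_apply] at hx
  -- hx : g⁻¹ (u⁻¹ (g x)) = x  ⇒  u⁻¹ (g x) = g x  ⇒  u (g x) = g x
  have hx' : u⁻¹ (g (x : d.Ω)) = g (x : d.Ω) := by
    have := congrArg g hx
    rwa [← AlgEquiv.mul_apply, mul_inv_cancel, AlgEquiv.one_apply] at this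
  have := congrArg u hx'
  rwa [← AlgEquiv.mul_apply, mul_inv_cancel, AlgEquiv.one_apply, eq_comm] at this

/-- **The ring homomorphism `Ω^V → Ω^U`, `x ↦ g·x`, attached to a morphism `G/U → G/V` with point `g·V`** (the
morphism `Spec Ω^U → Spec Ω^V` of `D⊢_v ⊆ D₀`). [cite: Mochizuki2012, I Ex 3.3 (i) p.78] -/
noncomputable def fixedHom {X Y : CosetCat d.Gal} (f : X ⟶ Y) : d.fixedFld Y →+* d.fixedFld X where
  toFun x := ⟨(Quotient.out (CosetCat.pt f)) (x : d.Ω), d.out_apply_mem f x⟩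
  map_one' := Subtype.ext (by change (Quotient.out (CosetCat.pt f)) ((1 : d.fixedFld Y) : d.Ω) = 1; simp)
  map_mul' x y := Subtype.ext (by
    change (Quotient.out (CosetCat.pt f)) ((x * y : d.fixedFld Y) : d.Ω) = _
    rw [MulMemClass.coe_mul, map_mul]; rfl)
  map_zero' := Subtype.ext (by change (Quotient.out (CosetCat.pt f)) ((0 : d.fixedFld Y) : d.Ω) = 0; simp)
  map_add' x y := Subtype.ext (by
    change (Quotient.out (CosetCat.pt f)) ((x + y : d.fixedFld Y) : d.Ω) = _
    rw [AddMemClass.coe_add, map_add]; rfl)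

/-- `fixedHom f x = g x` for ANY representative `g` of the point of `f`. [cite: Mochizuki2012, I Ex 3.3 (i) p.78] -/
theorem fixedHom_apply_coe {X Y : CosetCat d.Gal} (f : X ⟶ Y) (g : d.Gal)
    (hg : CosetCat.pt f = (g : d.Gal ⧸ Y.sg.toSubgroup)) (x : d.fixedFld Y) :
    ((d.fixedHom f x : d.fixedFld X) : d.Ω) = g (x : d.Ω) := by
  change (Quotient.out (CosetCat.pt f)) (x : d.Ω) = _
  rw [hg, out_apply_eq]

/-- `fixedHom f` preserves and reflects the (restricted) valuative relations: `Gal(Ω/k)` preserves the valuation of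
`Ω` (`val_aut`). [cite: Mochizuki2012, I Ex 3.3 (i) p.78] -/
theorem fixedHom_vle_iff {X Y : CosetCat d.Gal} (f : X ⟶ Y) (a b : d.fixedFld Y) :
    @ValuativeRel.vle (d.fixedFld X) _ (d.valOn (d.fixedFld X)) (d.fixedHom f a) (d.fixedHom f b) ↔
      @ValuativeRel.vle (d.fixedFld Y) _ (d.valOn (d.fixedFld Y)) a b := by
  obtain ⟨g, hg⟩ := Quotient.exists_rep (CosetCat.pt f)
  rw [d.valOn_iff, d.valOn_iff, d.fixedHom_apply_coe f g hg.symm, d.fixedHom_apply_coe f g hg.symm, d.val_aut]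

/-- `fixedHom f` is VALUATIVE (a morphism of `D₀`). [cite: Mochizuki2012, I Ex 3.3 (i) p.78] -/
theorem fixedHom_isValHom {X Y : CosetCat d.Gal} (f : X ⟶ Y) :
    @IsValHom (d.fieldObj X).K _ (d.fieldObj X).val (d.fieldObj Y).K _ (d.fieldObj Y).val (d.fixedHom f) :=
  fun a b => d.fixedHom_vle_iff f a b

/-- **The field functor `D⊢_v = 𝓑(K_v)⁰ → D₀`, `Spec L ↦ L`** on the small model: `G/U ↦ Ω^U` with its valuation,
`(G/U → G/V, 1 ↦ gV) ↦ (Ω^V → Ω^U, x ↦ g x)`. [cite: Mochizuki2012, I Ex 3.3 (i) p.78] -/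
noncomputable def fieldFunctor : CosetCat d.Gal ⥤ PadicFld.{u} p where
  obj := d.fieldObj
  map f := ⟨d.fixedHom f, d.fixedHom_isValHom f⟩
  map_id X := PadicFld.hom_ext (RingHom.ext fun x => Subtype.ext (by
    change (d.fixedHom (𝟙 X) x).1 = x.1
    rw [d.fixedHom_apply_coe (𝟙 X) 1 (CosetCat.pt_id X), AlgEquiv.one_apply]))
  map_comp {X Y Z} f f' := PadicFld.hom_ext (RingHom.ext fun x => Subtype.ext (by
    obtain ⟨g, hg⟩ := Quotient.exists_rep (CosetCat.pt f)
    obtain ⟨g', hg'⟩ := Quotient.exists_rep (CosetCat.pt f')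
    have hg1 : CosetCat.pt f = ((g : d.Gal) : Y.carrier) := hg.symm
    have hg2 : CosetCat.pt f' = ((g' : d.Gal) : Z.carrier) := hg'.symm
    have hgg : CosetCat.pt (f ≫ f') = ((g * g' : d.Gal) : Z.carrier) := by
      rw [CosetCat.pt_comp, hg1, CosetCat.toFun_coe, hg2, MulAction.Quotient.smul_coe, smul_eq_mul]
    change (d.fixedHom (f ≫ f') x).1 = (d.fixedHom f (d.fixedHom f' x)).1
    rw [d.fixedHom_apply_coe (f ≫ f') (g * g') hgg, d.fixedHom_apply_coe f g hg1,
      d.fixedHom_apply_coe f' g' hg2, AlgEquiv.mul_apply]))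

/-- The underlying ring homomorphism of `fieldFunctor.map f`. [cite: Mochizuki2012, I Ex 3.3 (i) p.78] -/
theorem fieldFunctor_map_alg {X Y : CosetCat d.Gal} (f : X ⟶ Y) : (d.fieldFunctor.map f).alg = d.fixedHom f := rfl

/-! ### Every `Ω^U`, `U` open, is a `p`-adic local field -/

/-- `Ω^U` is finite over `k` for `U` OPEN (infinite Galois theory: `U` is closed, so `Gal(Ω/Ω^U) = U`, and open
fixing subgroups correspond to finite subextensions). [cite: Mochizuki2012, I Ex 3.3 (i) p.78] -/
theorem finiteDimensional_fixedFld (X : CosetCat d.Gal) : FiniteDimensional d.k (d.fixedFld X) := by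
  refine (InfiniteGalois.isOpen_iff_finite (d.fixedFld X)).mp ?_
  have h : (d.fixedFld X).fixingSubgroup = X.sg.toSubgroup :=
    InfiniteGalois.fixingSubgroup_fixedField ⟨X.sg.toSubgroup, X.sg.isClosed⟩
  rw [h]
  exact X.sg.isOpen

/-- **`Spec Ω^U` is a `p`-adic local field** ("[i.e., `L` is a finite separable extension of `K_v`]"): finite over
`ℚ_p` through `k`, with compatible valuative relations. [cite: Mochizuki2012, I Ex 3.3 (i) p.78] -/
theorem fieldObj_isPadicLocal (X : CosetCat d.Gal) : (d.fieldObj X).IsPadicLocal := by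
  obtain ⟨⟨inst, hfin, hcomp⟩⟩ := d.isPadicLocal
  letI : Algebra ℚ_[p] d.k := inst
  haveI : Module.Finite ℚ_[p] d.k := hfin
  haveI := d.finiteDimensional_fixedFld X
  let algQ : Algebra ℚ_[p] (d.fixedFld X) :=
    ((algebraMap d.k (d.fixedFld X)).comp (algebraMap ℚ_[p] d.k)).toAlgebra
  refine ⟨⟨algQ, ?_, fun a b => ?_⟩⟩
  · letI := algQ
    haveI : IsScalarTower ℚ_[p] d.k (d.fixedFld X) := IsScalarTower.of_algebraMap_eq fun _ => rfl
    exact Module.Finite.trans d.k (d.fixedFld X)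
  · letI := algQ
    change @ValuativeRel.vle (d.fixedFld X) _ (d.valOn _) (algebraMap ℚ_[p] (d.fixedFld X) a)
      (algebraMap ℚ_[p] (d.fixedFld X) b) ↔ _
    rw [d.valOn_iff]
    change algebraMap d.k d.Ω (algebraMap ℚ_[p] d.k a) ≤ᵥ algebraMap d.k d.Ω (algebraMap ℚ_[p] d.k b) ↔ _
    rw [ValuativeExtension.vle_iff_vle]
    exact hcomp a b

/-- The field functor lands in `p`-adic local fields (the `hloc` hypothesis of the [FrdII] data).
[cite: Mochizuki2012, I Ex 3.3 (i) p.78] -/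
theorem fieldFunctor_isPadicLocal (X : CosetCat d.Gal) : (d.fieldFunctor.obj X).IsPadicLocal :=
  d.fieldObj_isPadicLocal X

end GaloisValDatum

/-! ### Non-vacuity: the datum of `ℚ_p` with `Ω = ℚ̄_p` and its spectral (`p`-adic) norm -/

section Padic

variable (p : ℕ) [Fact p.Prime]

/-- The valuative relation of `ℚ̄_p` defined by its `p`-adic (spectral) norm (Mathlib `PadicAlgCl`).
[cite: MochizukiFrdII2008, Ex 1.1 (i) p.7] -/
@[reducible] noncomputable def padicAlgClVal : ValuativeRel (PadicAlgCl p) :=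
  ValuativeRel.ofValuation (PadicAlgCl.valued p).v

omit [Fact p.Prime] in
/-- `x ≤ᵥ y` in `ℚ̄_p` iff `‖x‖ ≤ ‖y‖`. [cite: MochizukiFrdII2008, Ex 1.1 (i) p.7] -/
theorem padicAlgCl_vle_iff [Fact p.Prime] (x y : PadicAlgCl p) :
    @ValuativeRel.vle _ _ (padicAlgClVal p) x y ↔ ‖x‖ ≤ ‖y‖ := by
  change (PadicAlgCl.valued p).v x ≤ (PadicAlgCl.valued p).v y ↔ _
  rw [PadicAlgCl.valuation_def, PadicAlgCl.valuation_def]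
  exact Iff.rfl

/-- **The input datum EXISTS at `K_v = ℚ_p`**: `Ω := ℚ̄_p` with its spectral norm; the two "uniqueness of the
extension" hypotheses DISCHARGED by Mathlib (`PadicAlgCl.norm_extends`, `spectralNorm_eq_of_equiv`; the order comparison on `ℚ_p` is abc-iut-w4-d018's `QuasiTemperoid.padic_vle_iff_norm_le`), `ℚ̄_p/ℚ_p` Galois
(characteristic zero), `Spec ℚ_p` a `p`-adic local field (abc-iut-L1-t4's `isPadicLocal_qpFld`).
[claim: Mochizuki2012, status: disputed] -/
noncomputable def GaloisValDatum.ofPadic : GaloisValDatum.{0} p where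
  k := ℚ_[p]
  Ω := PadicAlgCl p
  valΩ := padicAlgClVal p
  isGalois := inferInstance
  valExt := @ValuativeExtension.mk _ _ _ _ _ (padicAlgClVal p) _ fun a b => by
    rw [padicAlgCl_vle_iff, Literature.AlgebraicGeometry.Frobenioids.QuasiTemperoid.padic_vle_iff_norm_le]
    change ‖(a : PadicAlgCl p)‖ ≤ ‖(b : PadicAlgCl p)‖ ↔ _
    rw [PadicAlgCl.norm_extends, PadicAlgCl.norm_extends]
  val_aut σ x y := by
    -- `Gal(ℚ̄_p/ℚ_p)` acts by isometries: the norm of `ℚ̄_p` IS the spectral norm (`spectralNorm_eq_of_equiv`;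
    -- cf. `Literature.NumberTheory.LFunctions.Dwork.norm_algEquiv_apply`)
    rw [padicAlgCl_vle_iff, padicAlgCl_vle_iff, ← PadicAlgCl.spectralNorm_eq p (σ x), ← PadicAlgCl.spectralNorm_eq p x,
      ← PadicAlgCl.spectralNorm_eq p (σ y), ← PadicAlgCl.spectralNorm_eq p y, ← spectralNorm_eq_of_equiv σ x,
      ← spectralNorm_eq_of_equiv σ y]
  p_mem := (qpFld p).p_mem
  p_lt := (qpFld p).p_lt
  isPadicLocal := isPadicLocal_qpFld p

/-- The input structure `GaloisValDatum p` is inhabited for every prime `p`. [claim: Mochizuki2012, status: disputed] -/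
theorem GaloisValDatum.nonempty : Nonempty (GaloisValDatum.{0} p) := ⟨GaloisValDatum.ofPadic p⟩

end Padic


end Literature.IUT.HodgeTheaters
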